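import Mathlib
import Summits.MatrixMultiplication.MatrixMultiplication.Theses.HiddenToeplitzCorners

/-!
# Pencil coherence — typed targets of the gen-3 strategist census (crux `HiddenCorners`, stmt-MatrixMultiplication-7492)

Companion of `STRATEGY-CENSUS.md` (gen 3) §6.1 / §7 / §4 S⁺₉.  Disproof-side material and two necessary conditions for the live
line `birth`; no `HiddenCorners_of` here (the census records why no constructive line is registered).

* `vecMulVec_mulVec_of_dotProduct_eq_zero` — the tautology behind PENCIL COHERENCE (§6.1): a rank-one matrix `a bᵀ` lies in the
  kernel space `L_v = {X : X v = 0}` for EVERY `v ⊥ b`.  Hence whatever certifies singularity of a pencil on `L_v` must, for all `v`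
  in the hyperplane `b^⊥` at once, certify the `r`-dimensional space `{T(a bᵀ) : a}` (proved, two lines).
* `AdjugateCoherence` — condition (C2) of census §7 for the entangled-adjugate line (`Lines/birth.lean`, `stub_adjugate_family`):
  if `T(X)·K·vec(adj X) = 0` on `{det X = 0}` then `T(X)·K·(v ⊗ w) = 0` for EVERY `X` and every `v ∈ ker X`, `w ∈ ker Xᵀ`
  (so `corank T(X) ≥ 2(r − rank X) − 1`, and `≥ (r − rank X)²` for `K` injective on `ker X ⊗ ker Xᵀ`; in particular every
  coefficient matrix `T_ab` has corank `≥ 2r − 3`).  Stated as a `Prop`; proof (paper, census §7): for `X + tM` with `M` generic in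
  `L_v ∩ L^w` the rank is `r − 1` and `adj = c(t)·v wᵀ`, `c ≢ 0`, for all but finitely many `t`; a linear pencil in `t` vanishing on a
  vector for infinitely many `t` vanishes identically.
* `AlmostCommutantLemma c` — the linear-algebra statement that closes the COMPRESSION STRATUM (census §4 S⁺₉, recommendation R2):
  a matrix on `ℂ^r ⊗ ℂ^m` whose commutator with every `X ⊗ 1` has rank `≤ ρ` is within rank `c·ρ` of `1 ⊗ R₀`.  Conjectured with
  `c ≤ 2`; examples in the census show `c ≥ 1/2` is needed.  Stated as a `Prop`.
-/

set_option linter.dupNamespace false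

namespace Summit.MatrixMultiplication.MatrixMultiplication.Cruxes.HiddenCorners.Coherence

open scoped BigOperators Matrix Kronecker

/-- The pencil `T(X) = Σ_ab X_ab • T_ab` (route convention). -/
noncomputable def pencil {r N : ℕ} (T : Fin r → Fin r → Matrix (Fin N) (Fin N) ℂ)
    (X : Matrix (Fin r) (Fin r) ℂ) : Matrix (Fin N) (Fin N) ℂ :=
  ∑ a : Fin r, ∑ b : Fin r, X a b • T a b

/-- **Pencil coherence, the tautology.** `a bᵀ ∈ L_v` whenever `b ⬝ᵥ v = 0`: the rank-one matrix `vecMulVec a b` kills every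
`v` orthogonal to `b`.  (Census §6.1: so `{T(a bᵀ) : a} ⊆ T(L_v)` for all `v ∈ b^⊥` simultaneously.) -/
theorem vecMulVec_mulVec_of_dotProduct_eq_zero {r : ℕ} (a b v : Fin r → ℂ) (h : b ⬝ᵥ v = 0) :
    (Matrix.vecMulVec a b).mulVec v = 0 := by
  funext i
  have : (Matrix.vecMulVec a b).mulVec v i = a i * (b ⬝ᵥ v) := by
    simp [Matrix.mulVec, dotProduct, Matrix.vecMulVec_apply, Finset.mul_sum, mul_assoc]
  rw [this, h, mul_zero]
  rfl

/-- For independent `v, v'` the kernel spaces `L_v, L_{v'}` span everything: every matrix is a sum of one killing `v` and one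
killing `v'` — recorded as the `Prop` used in census §6.1 case (i) (`r ≥ 3` supplies two independent directions in each `b^⊥`). -/
def KernelSpacesSpan : Prop :=
  ∀ (r : ℕ) (v v' : Fin r → ℂ), LinearIndependent ℂ ![v, v'] →
    ∀ X : Matrix (Fin r) (Fin r) ℂ, ∃ Y Y' : Matrix (Fin r) (Fin r) ℂ, Y.mulVec v = 0 ∧ Y'.mulVec v' = 0 ∧ X = Y + Y'

/-- **(C2) Adjugate coherence** (census §7; necessary condition for `stub_adjugate_family` of `Lines/birth.lean`).
If the entangled-adjugate kernel identity holds on the singular locus, then `T(X)` kills `K (v ⊗ w)` for every `X` and every pair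
`v ∈ ker X`, `w ∈ ker Xᵀ` — not only on the corank-one stratum. -/
def AdjugateCoherence : Prop :=
  ∀ (r N : ℕ) (T : Fin r → Fin r → Matrix (Fin N) (Fin N) ℂ) (K : Matrix (Fin N) (Fin r × Fin r) ℂ),
    (∀ X : Matrix (Fin r) (Fin r) ℂ, X.det = 0 →
      (pencil T X).mulVec (K.mulVec fun p : Fin r × Fin r => X.adjugate p.1 p.2) = 0) →
    ∀ (X : Matrix (Fin r) (Fin r) ℂ) (v w : Fin r → ℂ), X.mulVec v = 0 → Matrix.vecMul w X = 0 →
      (pencil T X).mulVec (K.mulVec fun p : Fin r × Fin r => v p.1 * w p.2) = 0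

/-- **Almost-commutant lemma with constant `c`** (census §4 S⁺₉, recommendation R2; conjectured for some absolute `c`).
A matrix on `ℂ^r ⊗ ℂ^m` whose commutator with every `X ⊗ 1_m` has rank at most `ρ` differs from some `1_r ⊗ R₀` by rank at most
`c · ρ`.  With it, the spectral-multiplicity argument of the census gives the law of ends on the whole compression stratum
`T(X) = U (X ⊗ 1_m) Vᵀ` (k4 lever L1), dense generators included. -/
def AlmostCommutantLemma (c : ℕ) : Prop :=
  ∀ (r m ρ : ℕ) (R : Matrix (Fin r × Fin m) (Fin r × Fin m) ℂ),
    (∀ X : Matrix (Fin r) (Fin r) ℂ,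
      (R * (X ⊗ₖ (1 : Matrix (Fin m) (Fin m) ℂ)) - (X ⊗ₖ (1 : Matrix (Fin m) (Fin m) ℂ)) * R).rank ≤ ρ) →
    ∃ R₀ : Matrix (Fin m) (Fin m) ℂ, (R - (1 : Matrix (Fin r) (Fin r) ℂ) ⊗ₖ R₀).rank ≤ c * ρ

end Summit.MatrixMultiplication.MatrixMultiplication.Cruxes.HiddenCorners.Coherence
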